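/-
Copyright (c) 2026. All rights reserved.
Released under Apache 2.0 license as described in the file LICENSE.
Authors: abc-iut cell, campaign-S prover seat abc-iut-S5 (wave 2).
-/
import Mathlib.Algebra.Module.Lattice
import Mathlib.RingTheory.Trace.Basic
import Mathlib.RingTheory.IntegralClosure.IsIntegralClosure.Basic
import HarnessLib

/-!
# The trace of an integral element lies in the base ring (finite algebras over the fraction field of a PID)

Auxiliary to the proof of [IUTchIV] Proposition 1.1 (Mochizuki, *Inter-universal Teichmüller
theory IV*, RIMS manuscript Apr. 2020, §1, kurims p. 9: "Let us regard `R_I` as an `R_*`-algebra …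
the desired inclusion follows immediately from the definition of the different ideal"), where it is
applied with `A = R_* = 𝒪_{k_*}` (a discrete valuation ring), `K = k_*` and `S = R_I ⊗ ℚ_p` (a finite
`k_*`-algebra which is NOT a field).

* `trace_mem_range_of_isIntegral` — for a principal ideal domain `A` with fraction field `K`, a
  commutative `K`-algebra `S` that is finite-dimensional over `K`, and `z ∈ S` integral over `A`:
  `Tr_{S/K}(z) ∈ A`.

Proof (classical; the field case is Atiyah–Macdonald Prop. 5.15 / Mathlib `Algebra.isIntegral_trace`):
the `A`-span `L` of `{z^j · b_i}` (`b` a `K`-basis of `S`, `j ≤ deg f` for a monic `f ∈ A[X]` killing `z`)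
is a finitely generated `z`-stable `A`-lattice in `S`, hence free over the PID `A` (Mathlib
`Submodule.IsLattice.free`); in an `A`-basis of `L` — which is a `K`-basis of `S`
(`Module.Basis.extendOfIsLattice`) — multiplication by `z` has a matrix with entries in `A`, so its
trace lies in `A`.  No separability or reducedness hypothesis is needed.
-/

namespace Literature.IUT.LogVolume

open Module Submodule Polynomial

variable {A K S : Type*} [CommRing A] [IsDomain A] [IsPrincipalIdealRing A] [Field K] [Algebra A K]
  [IsFractionRing A K] [CommRing S] [Algebra K S] [Algebra A S] [IsScalarTower A K S]
  [Module.Finite K S]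

/-- **The trace of an integral element is integral** (PID version, arbitrary finite algebras): for a
principal ideal domain `A` with fraction field `K`, a commutative `K`-algebra `S` of finite dimension and
`z ∈ S` integral over `A`, the trace `Tr_{S/K}(z)` lies in (the image of) `A`.  Used in the proof of
[IUTchIV] Prop. 1.1 (kurims p. 9) with `A = 𝒪_{k_*}`, `S = R_I ⊗ ℚ_p`.
[claim: Mochizuki2012, status: disputed] -/
theorem trace_mem_range_of_isIntegral {z : S} (hz : IsIntegral A z) :
    Algebra.trace K S z ∈ (algebraMap A K).range := by
  classical
  obtain ⟨f, hf, hfz⟩ := hz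
  set n : ℕ := f.natDegree with hn
  let ι := Module.Free.ChooseBasisIndex K S
  let b : Basis ι K S := Module.Free.chooseBasis K S
  -- the lattice `L = span_A { z^j * b i : j ≤ n, i }`
  let v : Fin (n + 1) × ι → S := fun ji => z ^ (ji.1 : ℕ) * b ji.2
  let L : Submodule A S := span A (Set.range v)
  have hvL : ∀ ji, v ji ∈ L := fun ji => subset_span ⟨ji, rfl⟩
  have hbL : ∀ i, b i ∈ L := fun i => by
    have := hvL (0, i)
    simpa [v] using this
  -- `z^(n+1)` is an `A`-combination of lower powers (monic relation)
  have hpow : ∀ i, z ^ (n + 1) * b i ∈ L := by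
    intro i
    -- `z^n = -∑_{m<n} f_m z^m`
    have hrel : z ^ n = -∑ m ∈ Finset.range n, algebraMap A S (f.coeff m) * z ^ m := by
      have h0 : Polynomial.eval₂ (algebraMap A S) z f = 0 := hfz
      rw [Polynomial.eval₂_eq_sum_range, Finset.sum_range_succ, ← hn] at h0
      have hlead : f.coeff n = 1 := by rw [hn]; exact hf.leadingCoeff
      rw [hlead, map_one, one_mul] at h0
      linear_combination h0
    have : z ^ (n + 1) * b i = -∑ m ∈ Finset.range n, f.coeff m • (z ^ (m + 1) * b i) := by
      rw [pow_succ', mul_assoc, hrel, neg_mul, Finset.sum_mul, mul_neg, Finset.mul_sum]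
      congr 1
      refine Finset.sum_congr rfl fun m _ => ?_
      rw [Algebra.smul_def]
      ring
    rw [this]
    refine neg_mem (sum_mem fun m hm => smul_mem _ _ ?_)
    have hm' : m + 1 < n + 1 := by
      have := Finset.mem_range.mp hm; omega
    exact hvL (⟨m + 1, hm'⟩, i)
  -- `L` is `z`-stable
  have hstab : ∀ x ∈ L, z * x ∈ L := by
    intro x hx
    refine span_induction (p := fun x _ => z * x ∈ L) ?_ ?_ ?_ ?_ hx
    · rintro _ ⟨⟨j, i⟩, rfl⟩
      simp only [v]
      by_cases hj : (j : ℕ) + 1 < n + 1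
      · have := hvL (⟨(j : ℕ) + 1, hj⟩, i)
        simpa [v, pow_succ', mul_assoc] using this
      · have hjn : (j : ℕ) = n := by have := j.2; omega
        rw [← mul_assoc, ← pow_succ', hjn]
        exact hpow i
    · simp
    · intro x y _ _ hx hy
      rw [mul_add]; exact add_mem hx hy
    · intro a x _ hx
      rw [mul_smul_comm]; exact smul_mem _ _ hx
  -- `L` is a lattice: finitely generated and spanning
  haveI hLat : IsLattice K L := by
    refine ⟨fg_span (Set.finite_range v), ?_⟩
    rw [eq_top_iff, ← b.span_eq, span_le]
    rintro _ ⟨i, rfl⟩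
    exact subset_span (hbL i)
  haveI : Module.IsTorsionFree A K :=
    Module.isTorsionFree_iff_algebraMap_injective.mpr (IsFractionRing.injective A K)
  let κ := Module.Free.ChooseBasisIndex A L
  let c : Basis κ A L := Module.Free.chooseBasis A L
  let c' : Basis κ K S := c.extendOfIsLattice K
  -- diagonal (indeed all) matrix entries of multiplication by `z` in the basis `c'` lie in `A`
  have hentry : ∀ j, c'.repr (z * c' j) j ∈ (algebraMap A K).range := by
    intro j
    let w : L := ⟨z * (c j : S), hstab _ (c j).2⟩
    have hw : (w : S) = ∑ i, algebraMap A K (c.repr w i) • c' i := by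
      conv_lhs => rw [← c.sum_repr w]
      simp only [c', Basis.extendOfIsLattice_apply, Submodule.coe_sum, Submodule.coe_smul_of_tower,
        algebraMap_smul]
    have hrepr : c'.repr (z * c' j) = fun i => algebraMap A K (c.repr w i) := by
      have hzw : z * c' j = (w : S) := by simp [w, c', Basis.extendOfIsLattice_apply]
      rw [hzw, hw, c'.repr_sum_self]
    refine ⟨c.repr w j, ?_⟩
    rw [hrepr]
  rw [Algebra.trace_eq_matrix_trace c' z, Matrix.trace]
  refine sum_mem fun j _ => ?_
  rw [Matrix.diag_apply, Algebra.leftMulMatrix_eq_repr_mul]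
  exact hentry j

end Literature.IUT.LogVolume
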